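import Summits.Ventures.CertifiedArithmetic.LowPrec.DoubleRoundingProductUnderflow
import Summits.Ventures.CertifiedArithmetic.LowPrec.DoubleRoundingProductCells

/-!
# Double rounding of products in the gap: the window law and the thresholds `t*(2), t*(3), t*(4)`

HONEST FRAMING (venture CertifiedArithmetic / cell `pub-lowprec`): certified error envelopes and
provably optimal rounding/accumulation schemes for low-precision formats under stated cost models;
every table by two implementations; no hardware or vendor claims.

`DoubleRoundingProductUnderflow.lean` (THEOREM N-mul-U) shows that a register quantum
`1 ≤ d = L_φ - L_ψ ≤ P_φ` binades finer than the quantum `q` of a deep source `φ` is harmful for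
products, and clause (U) (`DoubleRoundingProduct.lean`) that `d ≥ 2 P_φ` is innocuous
(`P_ψ ≥ 2 P_φ`, `F_φ ⊆ F_ψ`).  In the GAP `P_φ + 1 ≤ d ≤ 2 P_φ - 1` — write `t = 2 P_φ - d`,
`1 ≤ t ≤ P_φ - 1` — the answer depends on the arithmetic of odd significand pairs.  A product of
`φ`-data is `oa·ob·2^(α+β)·q²` with odd `oa, ob < 2^P`; relative to the quantum `q' = 2^-d q` of
`ψ` it is `K·2^-u·q'`, `K = oa·ob`, and ONLY products below `2^t q'` are inexact in `ψ`
(`P_ψ ≥ 2P`).  The first rounding is then harmful exactly when the product lies within `q'/2`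
of a midpoint `(j + 1/2)·q` of `φ` on its ODD side (above it for even `j`, below for odd `j`):
`fl_ψ` moves it onto the midpoint, which `fl_φ` resolves to the even neighbour, across the
product.  §1 proves this WINDOW LAW as a slip criterion for every pair of records (soundness;
the converse — no window hit, no slip — is the midpoint theorem of `DoubleRoundingSlip.lean` and
is not needed for the certificates below); §2 instantiates it on pseudo-records small enough for
kernel exhaustion of the complementary cells, realising the least failing `t`:

  `t*(2) = 1` (`9 = 3·3 = 2^3 + 1`),  `t*(3) = 3` (`9 = 3·3`, `t = 1, 2` hold),
  `t*(4) = 2` (`65 = 5·13 = 2^6 + 1`, `t = 1` holds)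

— so for `P = 2` clause (U) is exact, for `P = 3` the innocuous region extends two binades below
it (`d ≥ 4` suffices), for `P = 4` one binade (`d ≥ 7`); the threshold is NOT monotone in `P`
(implementation A tabulates `t*(P)` for `2 ≤ P ≤ 24` from the odd factorizations of the integers
next to the midpoint counts `(2j+1)·2^n`: `t*(5) = 1` by `513 = 19·27`, `t*(6) = 2` and
`t*(7) = 4` by `1025 = 25·41`, `t*(8) = 2` by `16385 = 113·145`, `t*(11) = 4`, `t*(18) = 1` by
`2^35 + 1 = 132913·258513`, `t*(24) = 2` by `2^46 + 1 = 8384513·8392705`; `t*(P) ≤ 4` throughout).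

* §1 `roundNE_roundNE_ne_window_above` / `_below` (pointwise, `x = K·2^-u·quantum ψ`) and the
  data form `not_drMul_of_window_above` / `_below` (`K = oa·ob`, data `oa·2^α`, `ob·2^β` quanta
  of `φ` with `α + β + u + 2 L_φ = L_ψ`); ties in `ψ` (`u = 1`, `K = N'·2 ± 1`) are admitted when
  `d ≥ 2` (the midpoint count `N' = (2j+1)·2^(d-1)` is then even).  (U1×) of the previous file
  is the hit `u = t = P`, `j = 0`, `K = (2^P - 1)(2^(P-1) + 1) = 2^(2P-1) + 2^(P-1) - 1`.
* §2 the pseudo-records `X2 = ⟨1,4,4,1⟩`, `X3 = ⟨2,6,6,3⟩`, `X4 = ⟨3,6,3,7⟩` (`P = 2, 3, 4`,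
  `L ≤ -2P`, at most `64` values) against registers of precision `2P` placed `t` binades short
  of clause (U): `window_P2`, `window_P3`, `window_P4`.

Two implementations: A = `code/enum/mul_underflow_law.py` (brute force over all products of
pseudo-records `2 ≤ P ≤ 5`, every `t`, against the window predicate; the `t*(P)` table twice —
by the window predicate and by direct search of slipping products, `P ≤ 12`) →
`certs/enum/DOUBLE-ROUNDING-MUL-UNDERFLOW.json`; B = the kernel (this file).  PLACEMENT — KNOWN:
[Figueroa1995, §3], [Roux2014, Table II] (`e_min₂ ≤ 2 e_min₁`, clause (E)); the packet's clause
(U).  We found no statement in print of a precision-dependent exponent-range threshold for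
innocuous double rounding of products (searches listed in `DoubleRoundingProductUnderflow.lean`).
NEW here: the window law and the exact thresholds for `P = 2, 3, 4` as kernel theorems.
No hardware or vendor claims.
-/

namespace Summit.Ventures.CertifiedArithmetic

open Literature.ComputerArithmetic.FloatingPoint
open Literature.ComputerArithmetic.FloatingPoint.Format
open Literature.ComputerArithmetic.FloatingPoint.MiniFloat

/-! ## §1 The window law: a product within `quantum ψ / 2` of a midpoint, on its odd side, slips -/

/-- DATA WITH A PRESCRIBED PRODUCT: significands `oa, ob < 2^(m+1)` at exponents `α, β` in
range of `φ` with `α + β + u + 2 L_φ = L_ψ` give data `a, b` of `φ` with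
`a · b = oa·ob·2^-u·quantum ψ`. [folklore] -/
theorem exists_mul_eq_natMul_div {φ ψ : Format} {oa ob α β u : ℕ}
    (hoa : oa < 2 ^ (φ.manBits + 1)) (hob : ob < 2 ^ (φ.manBits + 1))
    (ha : oa * 2 ^ α ≤ φ.maxScaled) (hb : ob * 2 ^ β ≤ φ.maxScaled)
    (hexp : ((α + β + u : ℕ) : ℤ) + 2 * φ.qexp = ψ.qexp) :
    ∃ a b : MiniFloat φ, a.toRat * b.toRat = ((oa * ob : ℕ) : ℚ) * ψ.quantum / 2 ^ u := by
  obtain ⟨a, ha'⟩ := exists_toRat_eq_natMul (representable_mul_pow (φ := φ) hoa ha)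
  obtain ⟨b, hb'⟩ := exists_toRat_eq_natMul (representable_mul_pow (φ := φ) hob hb)
  refine ⟨a, b, ?_⟩
  have hunit : (2 : ℚ) ^ α * 2 ^ β * φ.quantum * φ.quantum * 2 ^ u = ψ.quantum := by
    unfold Format.quantum
    rw [← hexp, zpow_add₀ (by norm_num : (2 : ℚ) ≠ 0), zpow_natCast, two_mul,
      zpow_add₀ (by norm_num : (2 : ℚ) ≠ 0), pow_add, pow_add]
    ring
  rw [ha', hb', eq_div_iff (by positivity), ← hunit]
  push_cast
  ring

/-- THE WINDOW ABOVE A MIDPOINT, pointwise (`q = quantum φ = 2^d·q'`, `q' = quantum ψ`, `d ≥ 1`,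
`m = m_φ ≥ 1`): for an EVEN `j` with `j + 1` a datum of `φ` (`j + 1 < 2^(m+1)`, `j + 1 ≤ M_φ`),
the midpoint `(j + 1/2)·q = N'·q'`, `N' = (2j+1)·2^(d-1)`, a value of `ψ` (`2j + 1 < 2^(m_ψ+1)`,
`N' ≤ M_ψ`), and a rational `x = K·2^-u·q'` with `N'·2^u < K` and `2 (K - N'·2^u) ≤ 2^u` — at
equality (a tie in `ψ`, only for `u = 1`) also `d ≥ 2` and `N' + 1` a low datum of `ψ` — the double
rounding slips: `fl_ψ x = (j + 1/2)·q` (within half a quantum of `ψ`, or a tie resolved to the even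
`N'`), `fl_φ` of it is `j·q` (tie to even), while `fl_φ x = (j+1)·q`. [this packet] -/
theorem roundNE_roundNE_ne_window_above {φ ψ : Format} (hq : ψ.qexp + 1 ≤ φ.qexp)
    (h1 : 1 ≤ φ.manBits) {K u j : ℕ} (hj : Even j) (hjm : j + 1 < 2 ^ (φ.manBits + 1))
    (hjM : j + 1 ≤ φ.maxScaled) (hjψ : 2 * j + 1 < 2 ^ (ψ.manBits + 1))
    (hMψ : (2 * j + 1) * 2 ^ ((φ.qexp - ψ.qexp).toNat - 1) ≤ ψ.maxScaled)
    (hlo : (2 * j + 1) * 2 ^ ((φ.qexp - ψ.qexp).toNat - 1 + u) < K)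
    (hhi : 2 * (K - (2 * j + 1) * 2 ^ ((φ.qexp - ψ.qexp).toNat - 1 + u)) ≤ 2 ^ u)
    (htie : 2 * (K - (2 * j + 1) * 2 ^ ((φ.qexp - ψ.qexp).toNat - 1 + u)) = 2 ^ u →
      2 ≤ (φ.qexp - ψ.qexp).toNat ∧
      (2 * j + 1) * 2 ^ ((φ.qexp - ψ.qexp).toNat - 1) + 1 < 2 ^ (ψ.manBits + 1) ∧
      (2 * j + 1) * 2 ^ ((φ.qexp - ψ.qexp).toNat - 1) + 1 ≤ ψ.maxScaled) :
    (roundNE φ (roundNE ψ (((K : ℕ) : ℚ) * ψ.quantum / 2 ^ u)).toRat).toRat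
      ≠ (roundNE φ (((K : ℕ) : ℚ) * ψ.quantum / 2 ^ u)).toRat := by
  have hq0 := φ.quantum_pos
  have hq1 := ψ.quantum_pos
  set d := (φ.qexp - ψ.qexp).toNat with hd'
  have hd1 : 1 ≤ d := by omega
  have hQ : φ.quantum = 2 ^ d * ψ.quantum := quantum_eq_two_pow_mul (by omega)
  have hd2 : (2 : ℚ) ^ d = 2 * 2 ^ (d - 1) := by rw [← pow_succ']; congr 1; omega
  set N' := (2 * j + 1) * 2 ^ (d - 1) with hN'
  have hN : (2 * j + 1) * 2 ^ (d - 1 + u) = N' * 2 ^ u := by rw [hN', pow_add, mul_assoc]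
  rw [hN] at hlo hhi htie
  have hmid : ((N' : ℕ) : ℚ) * ψ.quantum = ((2 * j + 1 : ℕ) : ℚ) / 2 * φ.quantum := by
    rw [hN', hQ, hd2]; push_cast; ring
  have h2u : (0 : ℚ) < 2 ^ u := by positivity
  set x := ((K : ℕ) : ℚ) * ψ.quantum / 2 ^ u with hx
  set ε := (((K : ℕ) : ℚ) - N' * 2 ^ u) * ψ.quantum / 2 ^ u with hε
  have hxε : x = ((N' : ℕ) : ℚ) * ψ.quantum + ε := by
    rw [hx, hε]; field_simp; ring
  have hKN : ((N' * 2 ^ u : ℕ) : ℚ) < K := by exact_mod_cast hlo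
  push_cast at hKN
  have hε0 : 0 < ε := by rw [hε]; exact div_pos (mul_pos (by linarith) hq1) h2u
  have hdiff : ((2 * (K - N' * 2 ^ u) : ℕ) : ℚ) = 2 * (((K : ℕ) : ℚ) - N' * 2 ^ u) := by
    rw [Nat.cast_mul, Nat.cast_sub hlo.le]; push_cast; ring
  have e2ε : 2 * ε = 2 * (((K : ℕ) : ℚ) - N' * 2 ^ u) / 2 ^ u * ψ.quantum := by rw [hε]; ring
  have hε2 : 2 * ε ≤ ψ.quantum := by
    have h : ((2 * (K - N' * 2 ^ u) : ℕ) : ℚ) ≤ ((2 ^ u : ℕ) : ℚ) := by exact_mod_cast hhi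
    rw [hdiff] at h; push_cast at h
    rw [e2ε]
    calc 2 * (((K : ℕ) : ℚ) - N' * 2 ^ u) / 2 ^ u * ψ.quantum ≤ 1 * ψ.quantum :=
          mul_le_mul_of_nonneg_right (by rw [div_le_one h2u]; exact h) hq1.le
      _ = ψ.quantum := one_mul _
  -- `fl_ψ x = N'·q'`
  have hY : (roundNE ψ x).toRat = ((N' : ℕ) : ℚ) * ψ.quantum := by
    rcases hhi.lt_or_eq with hlt | heq
    · rw [hxε]
      refine toRat_roundNE_natMul_add_small (representable_mul_pow hjψ hMψ) ?_
      rw [abs_of_pos hε0]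
      have h : ((2 * (K - N' * 2 ^ u) : ℕ) : ℚ) < ((2 ^ u : ℕ) : ℚ) := by exact_mod_cast hlt
      rw [hdiff] at h; push_cast at h
      rw [e2ε]
      calc 2 * (((K : ℕ) : ℚ) - N' * 2 ^ u) / 2 ^ u * ψ.quantum < 1 * ψ.quantum :=
            mul_lt_mul_of_pos_right (by rw [div_lt_one h2u]; exact h) hq1
        _ = ψ.quantum := one_mul _
    · obtain ⟨hd3, hj2, hM2⟩ := htie heq
      have h : ((2 * (K - N' * 2 ^ u) : ℕ) : ℚ) = ((2 ^ u : ℕ) : ℚ) := by exact_mod_cast heq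
      rw [hdiff] at h; push_cast at h
      have hεeq : ε = ψ.quantum / 2 := by
        rw [hε, show ((K : ℕ) : ℚ) - N' * 2 ^ u = 2 ^ u / 2 by linarith]
        field_simp
      have hev : Even N' := by
        obtain ⟨e, he⟩ : ∃ e, d - 1 = e + 1 := ⟨d - 2, by omega⟩
        rw [hN', he, pow_succ]; exact ⟨(2 * j + 1) * 2 ^ e, by ring⟩
      have hN2 : 2 ≤ N' := by
        rw [hN']
        calc 2 = 1 * 2 ^ 1 := by norm_num
          _ ≤ (2 * j + 1) * 2 ^ (d - 1) :=
            Nat.mul_le_mul (by omega) (Nat.pow_le_pow_right (by norm_num) (by omega))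
      have h1ψ : 1 ≤ ψ.manBits := by
        rcases Nat.eq_zero_or_pos ψ.manBits with h0 | h0
        · rw [h0] at hj2; norm_num at hj2; omega
        · exact h0
      have e : x = ((2 * N' + 1 : ℕ) : ℚ) / 2 * ψ.quantum := by
        rw [hxε, hεeq]; push_cast; ring
      rw [e]
      exact toRat_roundNE_half_of_even h1ψ hev hj2 hM2
  -- the two roundings in `φ`
  have hψφ : 2 * ψ.quantum ≤ φ.quantum := by
    rw [hQ]
    have : (2 : ℚ) ≤ 2 ^ d := by
      calc (2 : ℚ) = 2 ^ 1 := by norm_num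
        _ ≤ 2 ^ d := pow_le_pow_right₀ (by norm_num) hd1
    nlinarith
  have hX1 : (roundNE φ (roundNE ψ x).toRat).toRat = (j : ℚ) * φ.quantum := by
    rw [hY, hmid]; exact toRat_roundNE_half_of_even h1 hj hjm hjM
  have hX2 : (roundNE φ x).toRat = ((j + 1 : ℕ) : ℚ) * φ.quantum := by
    have e : x = ((j + 1 : ℕ) : ℚ) * φ.quantum + (ε - φ.quantum / 2) := by
      rw [hxε, hmid]; push_cast; ring
    rw [e]
    refine toRat_roundNE_natMul_add_small (representable_of_lt_pow hjm hjM) ?_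
    rw [abs_of_neg (by linarith)]
    linarith
  rw [hX1, hX2]; push_cast
  intro h; have := mul_right_cancel₀ hq0.ne' h; linarith

/-- THE WINDOW BELOW A MIDPOINT, pointwise: as `roundNE_roundNE_ne_window_above` with an ODD `j`
and `x = K·2^-u·q'`, `K < N'·2^u`, `2 (N'·2^u - K) ≤ 2^u` (at equality also `d ≥ 2` and
`N' < 2^(m_ψ+1)`): `fl_ψ x = (j + 1/2)·q ↦ (j+1)·q` (tie to even), while `fl_φ x = j·q`.
[this packet] -/
theorem roundNE_roundNE_ne_window_below {φ ψ : Format} (hq : ψ.qexp + 1 ≤ φ.qexp)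
    (h1 : 1 ≤ φ.manBits) {K u j : ℕ} (hj : Odd j) (hjm : j + 1 < 2 ^ (φ.manBits + 1))
    (hjM : j + 1 ≤ φ.maxScaled) (hjψ : 2 * j + 1 < 2 ^ (ψ.manBits + 1))
    (hMψ : (2 * j + 1) * 2 ^ ((φ.qexp - ψ.qexp).toNat - 1) ≤ ψ.maxScaled)
    (hlo : K < (2 * j + 1) * 2 ^ ((φ.qexp - ψ.qexp).toNat - 1 + u))
    (hhi : 2 * ((2 * j + 1) * 2 ^ ((φ.qexp - ψ.qexp).toNat - 1 + u) - K) ≤ 2 ^ u)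
    (htie : 2 * ((2 * j + 1) * 2 ^ ((φ.qexp - ψ.qexp).toNat - 1 + u) - K) = 2 ^ u →
      2 ≤ (φ.qexp - ψ.qexp).toNat ∧
      (2 * j + 1) * 2 ^ ((φ.qexp - ψ.qexp).toNat - 1) < 2 ^ (ψ.manBits + 1)) :
    (roundNE φ (roundNE ψ (((K : ℕ) : ℚ) * ψ.quantum / 2 ^ u)).toRat).toRat
      ≠ (roundNE φ (((K : ℕ) : ℚ) * ψ.quantum / 2 ^ u)).toRat := by
  have hq0 := φ.quantum_pos
  have hq1 := ψ.quantum_pos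
  set d := (φ.qexp - ψ.qexp).toNat with hd'
  have hd1 : 1 ≤ d := by omega
  have hQ : φ.quantum = 2 ^ d * ψ.quantum := quantum_eq_two_pow_mul (by omega)
  have hd2 : (2 : ℚ) ^ d = 2 * 2 ^ (d - 1) := by rw [← pow_succ']; congr 1; omega
  set N' := (2 * j + 1) * 2 ^ (d - 1) with hN'
  have hN : (2 * j + 1) * 2 ^ (d - 1 + u) = N' * 2 ^ u := by rw [hN', pow_add, mul_assoc]
  rw [hN] at hlo hhi htie
  have hN1 : 1 ≤ N' := by
    rw [hN']
    exact le_trans Nat.one_le_two_pow (Nat.le_mul_of_pos_left _ (by omega))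
  have hmid : ((N' : ℕ) : ℚ) * ψ.quantum = ((2 * j + 1 : ℕ) : ℚ) / 2 * φ.quantum := by
    rw [hN', hQ, hd2]; push_cast; ring
  have h2u : (0 : ℚ) < 2 ^ u := by positivity
  set x := ((K : ℕ) : ℚ) * ψ.quantum / 2 ^ u with hx
  set ε := (((N' : ℕ) : ℚ) * 2 ^ u - K) * ψ.quantum / 2 ^ u with hε
  have hxε : x = ((N' : ℕ) : ℚ) * ψ.quantum + -ε := by
    rw [hx, hε]; field_simp; ring
  have hKN : ((K : ℕ) : ℚ) < ((N' * 2 ^ u : ℕ) : ℚ) := by exact_mod_cast hlo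
  push_cast at hKN
  have hε0 : 0 < ε := by rw [hε]; exact div_pos (mul_pos (by linarith) hq1) h2u
  have hdiff : ((2 * (N' * 2 ^ u - K) : ℕ) : ℚ) = 2 * (((N' : ℕ) : ℚ) * 2 ^ u - K) := by
    rw [Nat.cast_mul, Nat.cast_sub hlo.le]; push_cast; ring
  have e2ε : 2 * ε = 2 * (((N' : ℕ) : ℚ) * 2 ^ u - K) / 2 ^ u * ψ.quantum := by rw [hε]; ring
  -- `fl_ψ x = N'·q'`
  have hY : (roundNE ψ x).toRat = ((N' : ℕ) : ℚ) * ψ.quantum := by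
    rcases hhi.lt_or_eq with hlt | heq
    · rw [hxε]
      refine toRat_roundNE_natMul_add_small (representable_mul_pow hjψ hMψ) ?_
      rw [abs_neg, abs_of_pos hε0]
      have h : ((2 * (N' * 2 ^ u - K) : ℕ) : ℚ) < ((2 ^ u : ℕ) : ℚ) := by exact_mod_cast hlt
      rw [hdiff] at h; push_cast at h
      rw [e2ε]
      calc 2 * (((N' : ℕ) : ℚ) * 2 ^ u - K) / 2 ^ u * ψ.quantum < 1 * ψ.quantum :=
            mul_lt_mul_of_pos_right (by rw [div_lt_one h2u]; exact h) hq1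
        _ = ψ.quantum := one_mul _
    · obtain ⟨hd3, hj2⟩ := htie heq
      have h : ((2 * (N' * 2 ^ u - K) : ℕ) : ℚ) = ((2 ^ u : ℕ) : ℚ) := by exact_mod_cast heq
      rw [hdiff] at h; push_cast at h
      have hεeq : ε = ψ.quantum / 2 := by
        rw [hε, show ((N' : ℕ) : ℚ) * 2 ^ u - K = 2 ^ u / 2 by linarith]
        field_simp
      have hodd : Odd (N' - 1) := by
        obtain ⟨e, he⟩ : ∃ e, d - 1 = e + 1 := ⟨d - 2, by omega⟩
        refine ⟨(2 * j + 1) * 2 ^ e - 1, ?_⟩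
        have : 1 ≤ (2 * j + 1) * 2 ^ e :=
          le_trans Nat.one_le_two_pow (Nat.le_mul_of_pos_left _ (by omega))
        rw [hN', he, pow_succ, ← mul_assoc]; omega
      have hN2 : 2 ≤ N' := by
        rw [hN']
        calc 2 = 1 * 2 ^ 1 := by norm_num
          _ ≤ (2 * j + 1) * 2 ^ (d - 1) :=
            Nat.mul_le_mul (by omega) (Nat.pow_le_pow_right (by norm_num) (by omega))
      have h1ψ : 1 ≤ ψ.manBits := by
        rcases Nat.eq_zero_or_pos ψ.manBits with h0 | h0
        · rw [h0] at hj2; norm_num at hj2; omega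
        · exact h0
      have ecast : ((2 * (N' - 1) + 1 : ℕ) : ℚ) = 2 * ((N' : ℕ) : ℚ) - 1 := by
        push_cast [Nat.cast_sub hN1]; ring
      have e : x = ((2 * (N' - 1) + 1 : ℕ) : ℚ) / 2 * ψ.quantum := by
        rw [ecast, hxε, hεeq]; ring
      rw [e, toRat_roundNE_half_of_odd h1ψ hodd (by rw [Nat.sub_add_cancel hN1]; exact hj2)
        (by rw [Nat.sub_add_cancel hN1]; exact hMψ), Nat.sub_add_cancel hN1]
  -- the two roundings in `φ`
  have hψφ : 2 * ψ.quantum ≤ φ.quantum := by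
    rw [hQ]
    have : (2 : ℚ) ≤ 2 ^ d := by
      calc (2 : ℚ) = 2 ^ 1 := by norm_num
        _ ≤ 2 ^ d := pow_le_pow_right₀ (by norm_num) hd1
    nlinarith
  have hε2 : 2 * ε ≤ ψ.quantum := by
    have h : ((2 * (N' * 2 ^ u - K) : ℕ) : ℚ) ≤ ((2 ^ u : ℕ) : ℚ) := by exact_mod_cast hhi
    rw [hdiff] at h; push_cast at h
    rw [e2ε]
    calc 2 * (((N' : ℕ) : ℚ) * 2 ^ u - K) / 2 ^ u * ψ.quantum ≤ 1 * ψ.quantum :=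
          mul_le_mul_of_nonneg_right (by rw [div_le_one h2u]; exact h) hq1.le
      _ = ψ.quantum := one_mul _
  have hX1 : (roundNE φ (roundNE ψ x).toRat).toRat = ((j + 1 : ℕ) : ℚ) * φ.quantum := by
    rw [hY, hmid]; exact toRat_roundNE_half_of_odd h1 hj hjm hjM
  have hX2 : (roundNE φ x).toRat = (j : ℚ) * φ.quantum := by
    have e : x = ((j : ℕ) : ℚ) * φ.quantum + (φ.quantum / 2 - ε) := by
      rw [hxε, hmid]; push_cast; ring
    rw [e]
    refine toRat_roundNE_natMul_add_small (representable_of_lt_pow (by omega) (by omega)) ?_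
    rw [abs_of_pos (by linarith)]
    linarith
  rw [hX1, hX2]; push_cast
  intro h; have := mul_right_cancel₀ hq0.ne' h; linarith

/-- THE WINDOW LAW, WITNESS FROM ABOVE — for EVERY pair of format records: data
`a = oa·2^α·q`, `b = ob·2^β·q` of `φ` (`oa, ob < 2^(m+1)`, in range) with
`α + β + u + 2 L_φ = L_ψ`, so that `a·b = oa·ob·2^-u·quantum ψ`, and the window hypotheses of
`roundNE_roundNE_ne_window_above` for `K = oa·ob` `⟹ ¬ DRMul φ ψ`: the product lies above the
midpoint `(j + 1/2)·quantum φ` (`j` even) by at most `quantum ψ / 2`. [this packet] -/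
theorem not_drMul_of_window_above {φ ψ : Format} (hq : ψ.qexp + 1 ≤ φ.qexp)
    (h1 : 1 ≤ φ.manBits) {oa ob α β u j : ℕ}
    (hoa : oa < 2 ^ (φ.manBits + 1)) (hob : ob < 2 ^ (φ.manBits + 1))
    (ha : oa * 2 ^ α ≤ φ.maxScaled) (hb : ob * 2 ^ β ≤ φ.maxScaled)
    (hexp : ((α + β + u : ℕ) : ℤ) + 2 * φ.qexp = ψ.qexp)
    (hj : Even j) (hjm : j + 1 < 2 ^ (φ.manBits + 1)) (hjM : j + 1 ≤ φ.maxScaled)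
    (hjψ : 2 * j + 1 < 2 ^ (ψ.manBits + 1))
    (hMψ : (2 * j + 1) * 2 ^ ((φ.qexp - ψ.qexp).toNat - 1) ≤ ψ.maxScaled)
    (hlo : (2 * j + 1) * 2 ^ ((φ.qexp - ψ.qexp).toNat - 1 + u) < oa * ob)
    (hhi : 2 * (oa * ob - (2 * j + 1) * 2 ^ ((φ.qexp - ψ.qexp).toNat - 1 + u)) ≤ 2 ^ u)
    (htie : 2 * (oa * ob - (2 * j + 1) * 2 ^ ((φ.qexp - ψ.qexp).toNat - 1 + u)) = 2 ^ u →
      2 ≤ (φ.qexp - ψ.qexp).toNat ∧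
      (2 * j + 1) * 2 ^ ((φ.qexp - ψ.qexp).toNat - 1) + 1 < 2 ^ (ψ.manBits + 1) ∧
      (2 * j + 1) * 2 ^ ((φ.qexp - ψ.qexp).toNat - 1) + 1 ≤ ψ.maxScaled) :
    ¬ DRMul φ ψ := by
  intro hD
  obtain ⟨a, b, hab⟩ := exists_mul_eq_natMul_div (ψ := ψ) hoa hob ha hb hexp
  have h := hD a b
  rw [hab] at h
  exact roundNE_roundNE_ne_window_above hq h1 hj hjm hjM hjψ hMψ hlo hhi htie h

/-- THE WINDOW LAW, WITNESS FROM BELOW — for EVERY pair of format records: as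
`not_drMul_of_window_above` with `j` odd and the product below the midpoint by at most
`quantum ψ / 2`. [this packet] -/
theorem not_drMul_of_window_below {φ ψ : Format} (hq : ψ.qexp + 1 ≤ φ.qexp)
    (h1 : 1 ≤ φ.manBits) {oa ob α β u j : ℕ}
    (hoa : oa < 2 ^ (φ.manBits + 1)) (hob : ob < 2 ^ (φ.manBits + 1))
    (ha : oa * 2 ^ α ≤ φ.maxScaled) (hb : ob * 2 ^ β ≤ φ.maxScaled)
    (hexp : ((α + β + u : ℕ) : ℤ) + 2 * φ.qexp = ψ.qexp)
    (hj : Odd j) (hjm : j + 1 < 2 ^ (φ.manBits + 1)) (hjM : j + 1 ≤ φ.maxScaled)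
    (hjψ : 2 * j + 1 < 2 ^ (ψ.manBits + 1))
    (hMψ : (2 * j + 1) * 2 ^ ((φ.qexp - ψ.qexp).toNat - 1) ≤ ψ.maxScaled)
    (hlo : oa * ob < (2 * j + 1) * 2 ^ ((φ.qexp - ψ.qexp).toNat - 1 + u))
    (hhi : 2 * ((2 * j + 1) * 2 ^ ((φ.qexp - ψ.qexp).toNat - 1 + u) - oa * ob) ≤ 2 ^ u)
    (htie : 2 * ((2 * j + 1) * 2 ^ ((φ.qexp - ψ.qexp).toNat - 1 + u) - oa * ob) = 2 ^ u →
      2 ≤ (φ.qexp - ψ.qexp).toNat ∧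
      (2 * j + 1) * 2 ^ ((φ.qexp - ψ.qexp).toNat - 1) < 2 ^ (ψ.manBits + 1)) :
    ¬ DRMul φ ψ := by
  intro hD
  obtain ⟨a, b, hab⟩ := exists_mul_eq_natMul_div (ψ := ψ) hoa hob ha hb hexp
  have h := hD a b
  rw [hab] at h
  exact roundNE_roundNE_ne_window_below hq h1 hj hjm hjM hjψ hMψ hlo hhi htie h

/-! ## §2 The thresholds `t*(2) = 1`, `t*(3) = 3`, `t*(4) = 2` on pseudo-records -/

/-- `P = 2` source, `L = -4 = -2P` (`20` values, max `1.5`). -/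
def X2 : Format := ⟨1, 4, 4, 1, by decide⟩
/-- `P = 4` register for `X2` at `t = 0` (`L = -8`, clause (U)). -/
def Y20 : Format := ⟨3, 6, 6, 7, by decide⟩
/-- `P = 4` register for `X2` at `t = 1` (`L = -7`). -/
def Y21 : Format := ⟨3, 5, 5, 7, by decide⟩
/-- `P = 3` source, `L = -7 ≤ -2P` (`56` values, max `1.75`). -/
def X3 : Format := ⟨2, 6, 6, 3, by decide⟩
/-- `P = 6` register for `X3` at `t = 1` (`L = -12`). -/
def Y31 : Format := ⟨5, 8, 8, 31, by decide⟩
/-- `P = 6` register for `X3` at `t = 2` (`L = -11`). -/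
def Y32 : Format := ⟨5, 7, 7, 31, by decide⟩
/-- `P = 6` register for `X3` at `t = 3` (`L = -10`). -/
def Y33 : Format := ⟨5, 6, 6, 31, by decide⟩
/-- `P = 4` source, `L = -8 = -2P` (`64` values, max `15/64`). -/
def X4 : Format := ⟨3, 6, 3, 7, by decide⟩
/-- `P = 8` register for `X4` at `t = 1` (`L = -15`). -/
def Y41 : Format := ⟨7, 9, 6, 127, by decide⟩
/-- `P = 8` register for `X4` at `t = 2` (`L = -14`). -/
def Y42 : Format := ⟨7, 8, 5, 127, by decide⟩

/-- `t*(2) = 1`: through a `P = 4` register the `P = 2` products are innocuous at `t = 0`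
(clause (U); here by exhaustion) and slip at `t = 1`: `3q · 3q = 9·2^-8 = (9/2)·q'`
(`q' = 2^-7 = q/8`) `↦ 4 q' = q/2 ↦ 0`, directly `q = 2^-4` — the window above the midpoint
`q/2`, `K = 9 = 2^3 + 1`, a tie in `ψ`. [this packet] -/
theorem window_P2 : DRMul X2 Y20 ∧ ¬ DRMul X2 Y21 :=
  ⟨drMul_of_all (by decide +kernel),
    not_drMul_of_window_above (φ := X2) (ψ := Y21) (oa := 3) (ob := 3) (α := 0) (β := 0) (u := 1)
      (j := 0) (by decide) (by decide) (by decide) (by decide) (by decide) (by decide) (by decide)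
      (by decide) (by decide) (by decide) (by decide) (by decide) (by decide) (by decide)
      (by decide)⟩

set_option maxHeartbeats 2000000 in
/-- `t*(3) = 3`: through a `P = 6` register the `P = 3` products are innocuous at `t = 1, 2`
(exhaustion of `56²` products each) and slip at `t = 3`: `6q · 12q = 9·2^-11 = (9/2)·q'`
(`q' = 2^-10 = q/8`) `↦ q/2 ↦ 0`, directly `q = 2^-7`. [this packet] -/
theorem window_P3 : DRMul X3 Y31 ∧ DRMul X3 Y32 ∧ ¬ DRMul X3 Y33 :=
  ⟨drMul_of_all (by decide +kernel), drMul_of_all (by decide +kernel),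
    not_drMul_of_window_above (φ := X3) (ψ := Y33) (oa := 3) (ob := 3) (α := 1) (β := 2) (u := 1)
      (j := 0) (by decide) (by decide) (by decide) (by decide) (by decide) (by decide) (by decide)
      (by decide) (by decide) (by decide) (by decide) (by decide) (by decide) (by decide)
      (by decide)⟩

set_option maxHeartbeats 4000000 in
/-- `t*(4) = 2`: through a `P = 8` register the `P = 4` products are innocuous at `t = 1`
(exhaustion of `64²` products) and slip at `t = 2`: `5q · 26q = 65·2^-15 = (65/2)·q'`
(`q' = 2^-14 = q/64`) `↦ 32 q' = q/2 ↦ 0`, directly `q = 2^-8` (`65 = 5·13 = 2^6 + 1`).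
[this packet] -/
theorem window_P4 : DRMul X4 Y41 ∧ ¬ DRMul X4 Y42 :=
  ⟨drMul_of_all (by decide +kernel),
    not_drMul_of_window_above (φ := X4) (ψ := Y42) (oa := 5) (ob := 13) (α := 0) (β := 1) (u := 1)
      (j := 0) (by decide) (by decide) (by decide) (by decide) (by decide) (by decide) (by decide)
      (by decide) (by decide) (by decide) (by decide) (by decide) (by decide) (by decide)
      (by decide)⟩

end Summit.Ventures.CertifiedArithmetic
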